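import Summits.RiemannHypothesis.RiemannHypothesis.Theorems.JensenLogBandCanaryDefs
import Literature.NumberTheory.LFunctions.XiJensenRows
import Literature.NumberTheory.LFunctions.WangYang2024.TuranInequalitiesProofs
import Mathlib.Analysis.Complex.TaylorSeries
import Mathlib.Analysis.SpecificLimits.Basic
import HarnessLib

/-!
# E-CANARY-128 — D3, analytic half (1/2): the series of `canaryF`, Taylor at a centre, and the three tail bounds

RH-FREE. For the normalised row function `canaryF z = 8·ξ₁⁽¹²⁸⁾(z)/γ(128) = Σ_k canaryR k · z^k/k!`
(`…CanaryDefs`) this file proves, from tree inputs only: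

* §1 `canaryRho_succ_lt` / `canaryR_add_le` — `ρ_m = γ(m+1)/γ(m)` is strictly decreasing (Turán / log-concavity,
  tree `WangYang2024.xiTaylorCoeff_mul_lt_sq`, standard axioms) hence `canaryR (j+k) ≤ canaryR j · canaryR k`;
* §2 a geometric tail lemma; §3 `hasSum_canaryF` — the power series at `0` (tree `hasSum_xiTaylorCoeff_shift`,
  `n = 128`); `hasSum_canaryD` — the series of the normalised derivatives `canaryD j c = 8·ξ₁⁽¹²⁸⁺ʲ⁾(c)/γ(128)
  = Σ_k canaryR (k+j) c^k/k!` (same lemma at shift `128 + j`); `hasSum_canaryF_taylor` — Taylor's series of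
  `canaryF` at any centre `c` with coefficients `canaryD j c` (Mathlib `Complex.hasSum_taylorSeries_of_entire`);
* §4–§7 the majorant terms `canaryA j x k = canaryR (k+j) x^k/k!` and the three geometric bounds:
  `norm_canaryD_sub_canaryS_le` (series truncation `≤ canaryTrunc`), `summable_canaryA_zero_and_canaryFsum_le`
  (the real majorant `canaryFsum x = Σ_k canaryR k x^k/k! ≤ canaryFmaj N x + canaryTrunc 0 N x`),
  `summable_and_tsum_taylorTail_le` (`Σ_{j>K} canaryR j h^j/j! ≤ canaryTaylorTail K J h`), and the MAJORANT
  `norm_canaryD_le` (`‖canaryD j c‖ ≤ canaryR j · canaryFsum x` for `‖c‖ ≤ x`).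

The step rule itself (`PieceIneq ⇒ 0 < Re (canaryF z / I^d)` on the piece) is in `…CanaryAnalytic`.
Cell rh-jensen, E-CANARY D3 split (eng g8 lead: arithmetic half `checkPiece = true → PieceIneq`; analytic half: eng-4).
WHAT THIS IS NOT: soundness lemmas for ONE certified instance; no statement here bears on zeros of `ζ` or on RH.
-/

-- D-0017: the doubled namespace is by design.
set_option linter.dupNamespace false
set_option autoImplicit false

noncomputable section

namespace Summit.RiemannHypothesis.RiemannHypothesis.Theorems.JensenPolynomials.LogBand.Canary

open Literature.NumberTheory.LFunctions Literature.Analysis.Complex Complex Finset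
open scoped Nat

/-! ## 1. The coefficients: positivity, the ratio recursion, log-concavity -/

/-- `γ(m) > 0`. -/
theorem xiTaylorCoeff_pos' (m : ℕ) : 0 < xiTaylorCoeff m := xiTaylorCoeff_pos_holds m

/-- `canaryR k > 0`. -/
theorem canaryR_pos (k : ℕ) : 0 < canaryR k :=
  div_pos (xiTaylorCoeff_pos' _) (xiTaylorCoeff_pos' _)

/-- `canaryRho m > 0`. -/
theorem canaryRho_pos (m : ℕ) : 0 < canaryRho m :=
  div_pos (xiTaylorCoeff_pos' _) (xiTaylorCoeff_pos' _)

/-- `canaryR 0 = 1`. -/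
theorem canaryR_zero : canaryR 0 = 1 := by
  unfold canaryR; rw [Nat.add_zero]; exact div_self (xiTaylorCoeff_pos' _).ne'

/-- The ratio recursion `canaryR (k+1) = canaryR k · canaryRho (128+k)`. -/
theorem canaryR_succ (k : ℕ) : canaryR (k + 1) = canaryR k * canaryRho (128 + k) := by
  unfold canaryR canaryRho
  have h0 := (xiTaylorCoeff_pos' 128).ne'
  have h1 := (xiTaylorCoeff_pos' (128 + k)).ne'
  rw [show 128 + (k + 1) = 128 + k + 1 from by ring]
  field_simp

/-- **Log-concavity** (Turán / Csordas–Norfolk–Varga; tree `WangYang2024.xiTaylorCoeff_mul_lt_sq`):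
`canaryRho (m+1) < canaryRho m`. -/
theorem canaryRho_succ_lt (m : ℕ) : canaryRho (m + 1) < canaryRho m := by
  unfold canaryRho
  have h0 := xiTaylorCoeff_pos' m
  have h1 := xiTaylorCoeff_pos' (m + 1)
  have key := Literature.NumberTheory.LFunctions.WangYang2024.xiTaylorCoeff_mul_lt_sq m
  rw [show m + 1 + 1 = m + 2 from by ring, div_lt_div_iff₀ h1 h0]
  nlinarith [key]

/-- `canaryRho` is antitone: `m ≤ m' → canaryRho m' ≤ canaryRho m`. -/
theorem canaryRho_le_of_le {m m' : ℕ} (h : m ≤ m') : canaryRho m' ≤ canaryRho m := by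
  induction h with
  | refl => exact le_rfl
  | step _ ih => exact (canaryRho_succ_lt _).le.trans ih

/-- **Submultiplicativity** from log-concavity: `canaryR (j + k) ≤ canaryR j · canaryR k`. -/
theorem canaryR_add_le (j k : ℕ) : canaryR (j + k) ≤ canaryR j * canaryR k := by
  induction k with
  | zero => rw [Nat.add_zero, canaryR_zero, mul_one]
  | succ k ih =>
    rw [← Nat.add_assoc, canaryR_succ, canaryR_succ, ← mul_assoc]
    have hρ : canaryRho (128 + (j + k)) ≤ canaryRho (128 + k) := canaryRho_le_of_le (by omega)
    exact mul_le_mul ih hρ (canaryRho_pos _).le (mul_pos (canaryR_pos _) (canaryR_pos _)).le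

/-! ## 2. A geometric tail lemma -/

/-- If `0 ≤ a`, and `a (n+1) ≤ q · a n` for `n ≥ n₀` with `0 ≤ q < 1`, then the tail `Σ_i a (i + n₀)` is summable
and at most `a n₀ / (1 − q)`. -/
theorem summable_and_tsum_le_of_ratio_le {a : ℕ → ℝ} {q : ℝ} (n₀ : ℕ) (ha : ∀ n, 0 ≤ a n)
    (hq0 : 0 ≤ q) (hq1 : q < 1) (hr : ∀ n, n₀ ≤ n → a (n + 1) ≤ q * a n) :
    Summable (fun i => a (i + n₀)) ∧ ∑' i, a (i + n₀) ≤ a n₀ / (1 - q) := by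
  have hpow : ∀ i, a (i + n₀) ≤ a n₀ * q ^ i := by
    intro i
    induction i with
    | zero => simp
    | succ i ih =>
      calc a (i + 1 + n₀) = a (i + n₀ + 1) := by rw [Nat.add_right_comm]
        _ ≤ q * a (i + n₀) := hr _ (by omega)
        _ ≤ q * (a n₀ * q ^ i) := mul_le_mul_of_nonneg_left ih hq0
        _ = a n₀ * q ^ (i + 1) := by ring
  have hgeo : HasSum (fun i => a n₀ * q ^ i) (a n₀ / (1 - q)) := by
    rw [div_eq_mul_inv]
    exact (hasSum_geometric_of_lt_one hq0 hq1).mul_left (a n₀)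
  have hsum : Summable (fun i => a (i + n₀)) :=
    Summable.of_nonneg_of_le (fun i => ha _) hpow hgeo.summable
  exact ⟨hsum, hasSum_le hpow hsum.hasSum hgeo⟩

/-! ## 3. The series: `canaryF`, its normalised derivatives `canaryD`, Taylor at a centre -/

/-- The normalised derivatives `canaryD j c = 8·ξ₁⁽¹²⁸⁺ʲ⁾(c)/γ(128)` (`canaryD 0 = canaryF`; `canaryD j c` is the
`j`-th derivative of `canaryF` at `c`, a fact we never need to state as such). -/
def canaryD (j : ℕ) (c : ℂ) : ℂ := 8 * iteratedDeriv (128 + j) xiSq c / (xiTaylorCoeff 128 : ℂ)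

/-- `canaryD 0 = canaryF`. -/
theorem canaryD_zero (c : ℂ) : canaryD 0 c = canaryF c := rfl

/-- `γ(128) ≠ 0` in `ℂ`. -/
theorem xiTaylorCoeff128_ne_zero : (xiTaylorCoeff 128 : ℂ) ≠ 0 := by
  exact_mod_cast (xiTaylorCoeff_pos' 128).ne'

/-- **The derivative series**: `canaryD j c = Σ_k canaryR (k + j) · c^k / k!`. -/
theorem hasSum_canaryD (j : ℕ) (c : ℂ) :
    HasSum (fun k : ℕ => (canaryR (k + j) : ℂ) * c ^ k / (k ! : ℂ)) (canaryD j c) := by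
  have h := (hasSum_xiTaylorCoeff_shift (128 + j) c).div_const (xiTaylorCoeff 128 : ℂ)
  have key : (fun k : ℕ => (canaryR (k + j) : ℂ) * c ^ k / (k ! : ℂ)) =
      fun i : ℕ => (xiTaylorCoeff (128 + j + i) : ℂ) / (i ! : ℂ) * c ^ i / (xiTaylorCoeff 128 : ℂ) := by
    funext k
    unfold canaryR
    rw [show 128 + (k + j) = 128 + j + k from by ring]
    push_cast
    ring
  unfold canaryD
  rw [key]
  exact h

/-- **The power series at `0`**: `canaryF z = Σ_k canaryR k · z^k / k!`. -/
theorem hasSum_canaryF (z : ℂ) :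
    HasSum (fun k : ℕ => (canaryR k : ℂ) * z ^ k / (k ! : ℂ)) (canaryF z) := by
  have h := hasSum_canaryD 0 z
  rw [canaryD_zero] at h
  simpa using h

/-- `f⁽ⁿ⁺ᵏ⁾ = (f⁽ⁿ⁾)⁽ᵏ⁾` (restated privately to keep the imports light; cf. `XiJensenRows`). -/
private theorem iteratedDeriv_add_eq_iteratedDeriv' (f : ℂ → ℂ) (n k : ℕ) :
    iteratedDeriv (n + k) f = iteratedDeriv k (iteratedDeriv n f) := by
  rw [iteratedDeriv_eq_iterate, iteratedDeriv_eq_iterate, iteratedDeriv_eq_iterate, add_comm,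
    Function.iterate_add_apply]

/-- **Taylor's series of `canaryF` at any centre** `c`: `canaryF z = Σ_j (z − c)^j / j! · canaryD j c`
(entire function; Mathlib `Complex.hasSum_taylorSeries_of_entire`). -/
theorem hasSum_canaryF_taylor (c z : ℂ) :
    HasSum (fun j : ℕ => (z - c) ^ j / (j ! : ℂ) * canaryD j c) (canaryF z) := by
  have hd : Differentiable ℂ (iteratedDeriv 128 xiSq) :=
    differentiable_iteratedDeriv_of_entire differentiable_xiSq 128
  have h := ((Complex.hasSum_taylorSeries_of_entire hd c z).mul_left 8).div_const (xiTaylorCoeff 128 : ℂ)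
  have key : (fun j : ℕ => (z - c) ^ j / (j ! : ℂ) * canaryD j c) =
      fun j : ℕ => 8 * ((j ! : ℂ)⁻¹ • (z - c) ^ j • iteratedDeriv j (iteratedDeriv 128 xiSq) c) /
        (xiTaylorCoeff 128 : ℂ) := by
    funext j
    unfold canaryD
    rw [iteratedDeriv_add_eq_iteratedDeriv' xiSq 128 j, smul_eq_mul, smul_eq_mul]
    have hj : (j ! : ℂ) ≠ 0 := by exact_mod_cast Nat.factorial_ne_zero j
    field_simp
  unfold canaryF
  rw [key]
  exact h

/-! ## 4. The real majorant terms and their ratio -/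

/-- The nonnegative majorant terms `canaryA j x k = canaryR (k + j) · x^k / k!`. -/
def canaryA (j : ℕ) (x : ℝ) (k : ℕ) : ℝ := canaryR (k + j) * x ^ k / k !

/-- `canaryA j x k ≥ 0` for `x ≥ 0`. -/
theorem canaryA_nonneg (j : ℕ) {x : ℝ} (hx : 0 ≤ x) (k : ℕ) : 0 ≤ canaryA j x k :=
  div_nonneg (mul_nonneg (canaryR_pos _).le (pow_nonneg hx _)) (Nat.cast_nonneg _)

/-- The term ratio: `canaryA j x (k+1) = (canaryRho (128 + (k + j)) · x / (k+1)) · canaryA j x k`. -/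
theorem canaryA_succ (j : ℕ) (x : ℝ) (k : ℕ) :
    canaryA j x (k + 1) = (canaryRho (128 + (k + j)) * x / ((k + 1 : ℕ) : ℝ)) * canaryA j x k := by
  unfold canaryA
  rw [show k + 1 + j = k + j + 1 from by ring, canaryR_succ, Nat.factorial_succ, pow_succ]
  push_cast
  have hk : ((k : ℝ) + 1) ≠ 0 := by positivity
  have hf : ((k ! : ℕ) : ℝ) ≠ 0 := by positivity
  field_simp

/-- **Ratio bound.** If `m₀ ≤ 128 + (k + j)` and `n₁ ≤ k + 1` (`0 < n₁`, `0 ≤ x`) then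
`canaryA j x (k+1) ≤ (canaryRho m₀ · x / n₁) · canaryA j x k` (by antitonicity of `canaryRho`). -/
theorem canaryA_succ_le (j : ℕ) {x : ℝ} (hx : 0 ≤ x) {k m₀ n₁ : ℕ} (hm : m₀ ≤ 128 + (k + j))
    (hn : n₁ ≤ k + 1) (hn0 : 0 < n₁) :
    canaryA j x (k + 1) ≤ (canaryRho m₀ * x / (n₁ : ℝ)) * canaryA j x k := by
  rw [canaryA_succ]
  refine mul_le_mul_of_nonneg_right ?_ (canaryA_nonneg j hx k)
  have h1 : canaryRho (128 + (k + j)) ≤ canaryRho m₀ := canaryRho_le_of_le hm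
  have h2 : (n₁ : ℝ) ≤ ((k + 1 : ℕ) : ℝ) := by exact_mod_cast hn
  have hn0' : (0 : ℝ) < (n₁ : ℝ) := by exact_mod_cast hn0
  rw [mul_div_assoc, mul_div_assoc]
  exact mul_le_mul h1 (div_le_div_of_nonneg_left hx hn0' h2) (div_nonneg hx (Nat.cast_nonneg _))
    (canaryRho_pos _).le

/-- The norm of the `k`-th term of the derivative series is at most the majorant term (`‖c‖ ≤ x`). -/
theorem norm_term_le_canaryA (j : ℕ) {c : ℂ} {x : ℝ} (hc : ‖c‖ ≤ x) (k : ℕ) :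
    ‖(canaryR (k + j) : ℂ) * c ^ k / (k ! : ℂ)‖ ≤ canaryA j x k := by
  unfold canaryA
  rw [norm_div, norm_mul, Complex.norm_real, Complex.norm_natCast, norm_pow,
    Real.norm_of_nonneg (canaryR_pos _).le]
  have hx : 0 ≤ x := (norm_nonneg c).trans hc
  gcongr
  exact (canaryR_pos _).le

/-! ## 5. Truncation of the derivative series: `‖canaryD j c − canaryS j N c‖ ≤ canaryTrunc j N x` -/

/-- `canaryTruncQ` is monotone in `j` (the denominator `N − j + 2` decreases). -/
theorem canaryTruncQ_mono {j j' N : ℕ} {x : ℝ} (hx : 0 ≤ x) (hjj : j ≤ j') :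
    canaryTruncQ j N x ≤ canaryTruncQ j' N x := by
  unfold canaryTruncQ
  have h1 : ((N - j' + 2 : ℕ) : ℝ) ≤ ((N - j + 2 : ℕ) : ℝ) := by exact_mod_cast (by omega)
  have h2 : (0 : ℝ) < ((N - j' + 2 : ℕ) : ℝ) := by exact_mod_cast (by omega)
  exact div_le_div_of_nonneg_left (mul_nonneg (canaryRho_pos _).le hx) h2 h1

/-- `canaryTruncQ j N x ≥ 0` for `x ≥ 0`. -/
theorem canaryTruncQ_nonneg (j N : ℕ) {x : ℝ} (hx : 0 ≤ x) : 0 ≤ canaryTruncQ j N x :=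
  div_nonneg (mul_nonneg (canaryRho_pos _).le hx) (Nat.cast_nonneg _)

/-- **The truncation tail of the majorant series**: for `j ≤ N`, `0 ≤ x`, `canaryTruncQ j N x < 1`, the tail
`Σ_i canaryA j x (i + (N − j + 1))` is summable and at most `canaryTrunc j N x`. -/
theorem summable_and_tsum_canaryA_tail_le {j N : ℕ} {x : ℝ} (hjN : j ≤ N) (hx : 0 ≤ x)
    (hq : canaryTruncQ j N x < 1) :
    Summable (fun i => canaryA j x (i + (N - j + 1))) ∧
      ∑' i, canaryA j x (i + (N - j + 1)) ≤ canaryTrunc j N x := by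
  have hr : ∀ n, N - j + 1 ≤ n → canaryA j x (n + 1) ≤ canaryTruncQ j N x * canaryA j x n := by
    intro n hn
    unfold canaryTruncQ
    exact canaryA_succ_le j hx (by omega) (by omega) (by omega)
  obtain ⟨hs, hle⟩ := summable_and_tsum_le_of_ratio_le (N - j + 1) (canaryA_nonneg j hx)
    (canaryTruncQ_nonneg j N hx) hq hr
  refine ⟨hs, hle.trans (le_of_eq ?_)⟩
  unfold canaryTrunc canaryA
  rw [show N - j + 1 + j = N + 1 from by omega]

/-- **Series truncation.** For `‖c‖ ≤ x`, `j ≤ N` and `canaryTruncQ j N x < 1`: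
`‖canaryD j c − canaryS j N c‖ ≤ canaryTrunc j N x`. -/
theorem norm_canaryD_sub_canaryS_le {j N : ℕ} {c : ℂ} {x : ℝ} (hc : ‖c‖ ≤ x) (hjN : j ≤ N)
    (hq : canaryTruncQ j N x < 1) : ‖canaryD j c - canaryS j N c‖ ≤ canaryTrunc j N x := by
  have hx : 0 ≤ x := (norm_nonneg c).trans hc
  have hD := hasSum_canaryD j c
  have htail := (hasSum_nat_add_iff' (f := fun k : ℕ => (canaryR (k + j) : ℂ) * c ^ k / (k ! : ℂ))
    (N - j + 1)).mpr hD
  have hS : (∑ i ∈ range (N - j + 1), (canaryR (i + j) : ℂ) * c ^ i / (i ! : ℂ)) = canaryS j N c := rfl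
  rw [hS] at htail
  obtain ⟨hs, hle⟩ := summable_and_tsum_canaryA_tail_le hjN hx hq
  refine (htail.norm_le_of_bounded hs.hasSum fun i => norm_term_le_canaryA j hc _).trans hle

/-! ## 6. The real majorant `canaryFsum x = Σ_k canaryR k x^k/k!` and the bound `‖canaryD j c‖ ≤ canaryR j · canaryFsum x` -/

/-- The (real) majorant `canaryFsum x = Σ'_k canaryR k · x^k / k!` (`= canaryF x` for real `x ≥ 0`; we only use it
as an upper bound). -/
def canaryFsum (x : ℝ) : ℝ := ∑' k, canaryA 0 x k

/-- For `0 ≤ x` and `canaryTruncQ 0 N x < 1`: the majorant series is summable and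
`canaryFsum x ≤ canaryFmaj N x + canaryTrunc 0 N x`. -/
theorem summable_canaryA_zero_and_canaryFsum_le {N : ℕ} {x : ℝ} (hx : 0 ≤ x)
    (hq : canaryTruncQ 0 N x < 1) :
    Summable (canaryA 0 x) ∧ canaryFsum x ≤ canaryFmaj N x + canaryTrunc 0 N x := by
  obtain ⟨hs, hle⟩ := summable_and_tsum_canaryA_tail_le (Nat.zero_le N) hx hq
  rw [Nat.sub_zero] at hs hle
  have hs' : Summable (canaryA 0 x) := (summable_nat_add_iff (N + 1)).mp hs
  refine ⟨hs', ?_⟩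
  unfold canaryFsum
  rw [← hs'.sum_add_tsum_nat_add (N + 1)]
  have hmaj : (∑ i ∈ range (N + 1), canaryA 0 x i) = canaryFmaj N x := by
    unfold canaryFmaj canaryA
    simp only [Nat.add_zero]
  rw [hmaj]
  exact add_le_add le_rfl hle

/-- `canaryFsum x ≥ 0` (when summable, and in fact always: `tsum` of a nonnegative family). -/
theorem canaryFsum_nonneg {x : ℝ} (hx : 0 ≤ x) : 0 ≤ canaryFsum x :=
  tsum_nonneg (canaryA_nonneg 0 hx)

/-- **The log-concavity majorant**: for `‖c‖ ≤ x` (and the majorant series summable at `x`),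
`‖canaryD j c‖ ≤ canaryR j · canaryFsum x` (from `canaryR (k + j) ≤ canaryR j · canaryR k`). -/
theorem norm_canaryD_le {j : ℕ} {c : ℂ} {x : ℝ} (hc : ‖c‖ ≤ x) (hs : Summable (canaryA 0 x)) :
    ‖canaryD j c‖ ≤ canaryR j * canaryFsum x := by
  have hx : 0 ≤ x := (norm_nonneg c).trans hc
  have hD := hasSum_canaryD j c
  have hmaj : HasSum (fun k => canaryR j * canaryA 0 x k) (canaryR j * canaryFsum x) :=
    hs.hasSum.mul_left (canaryR j)
  refine hD.norm_le_of_bounded hmaj fun k => (norm_term_le_canaryA j hc k).trans ?_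
  unfold canaryA
  rw [Nat.add_zero, mul_div_assoc, mul_div_assoc, ← mul_assoc]
  refine mul_le_mul_of_nonneg_right ?_ (div_nonneg (pow_nonneg hx _) (Nat.cast_nonneg _))
  rw [Nat.add_comm]
  exact canaryR_add_le j k

/-! ## 7. The Taylor tail `Σ_{j > K} canaryR j h^j/j! ≤ canaryTaylorTail K J h` -/

/-- `canaryTaylorQ K J h ≥ 0` for `h ≥ 0`. -/
theorem canaryTaylorQ_nonneg (K J : ℕ) {h : ℝ} (hh : 0 ≤ h) : 0 ≤ canaryTaylorQ K J h :=
  div_nonneg (mul_nonneg (canaryRho_pos _).le hh) (Nat.cast_nonneg _)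

/-- **Taylor tail.** For `0 ≤ h` and `canaryTaylorQ K J h < 1`: `Σ_i canaryA 0 h (i + (K+1))` is summable and at
most `canaryTaylorTail K J h` (`J` explicit terms, then the geometric bound). -/
theorem summable_and_tsum_taylorTail_le {K J : ℕ} {h : ℝ} (hh : 0 ≤ h) (hq : canaryTaylorQ K J h < 1) :
    Summable (fun i => canaryA 0 h (i + (K + 1))) ∧
      ∑' i, canaryA 0 h (i + (K + 1)) ≤ canaryTaylorTail K J h := by
  -- geometric part from index K + J + 1 on
  have hr : ∀ n, K + J + 1 ≤ n → canaryA 0 h (n + 1) ≤ canaryTaylorQ K J h * canaryA 0 h n := by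
    intro n hn
    unfold canaryTaylorQ
    exact canaryA_succ_le 0 hh (by omega) (by omega) (by omega)
  obtain ⟨hs, hle⟩ := summable_and_tsum_le_of_ratio_le (K + J + 1) (canaryA_nonneg 0 hh)
    (canaryTaylorQ_nonneg K J hh) hq hr
  -- summability of the tail from K + 1
  have hsK : Summable (fun i => canaryA 0 h (i + (K + 1))) := by
    have : Summable (fun i => canaryA 0 h (i + J + (K + 1))) := by
      convert hs using 2 with i; congr 1; ring
    exact (summable_nat_add_iff J).mp this
  refine ⟨hsK, ?_⟩
  rw [← hsK.sum_add_tsum_nat_add J]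
  unfold canaryTaylorTail
  refine add_le_add ?_ ?_
  · -- the J explicit terms: reindex i ↦ i + (K+1)
    refine le_of_eq ?_
    rw [Finset.range_eq_Ico, Finset.sum_Ico_add' (canaryA 0 h) 0 J (K + 1), Nat.zero_add,
      show J + (K + 1) = K + J + 1 from by ring]
    refine Finset.sum_congr rfl fun n _ => ?_
    unfold canaryA
    rw [Nat.add_zero]
  · have heq : (fun i => canaryA 0 h (i + J + (K + 1))) = fun i => canaryA 0 h (i + (K + J + 1)) := by
      funext i; congr 1; ring
    rw [heq]
    refine hle.trans (le_of_eq ?_)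
    unfold canaryA
    rw [Nat.add_zero]

end Summit.RiemannHypothesis.RiemannHypothesis.Theorems.JensenPolynomials.LogBand.Canary

end
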